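import Summits.PneNP.PneNP.Theorems.OracleRefusal.Negative.StaInvChainCanon

/-!
# `OracleRefusal` (stmt-PneNP-1864) — negative side, II: Semantic inversion, part 9 (§B.10): under the binder of the tail, `λz. chain` (`lamz_runs`, `lamz_exists`), with the
transports `HeadsDesc.unshift0`, `HeadsDesc.mpx_empty` and presence of outer heads (`lamz_present`).
-/

namespace Summit.PneNP.PneNP.Theorems.OracleRefusal.Negative

open Literature.Computability.ImplicitComplexity
open Literature.Computability.ImplicitComplexity.URel
open Literature.Computability.ImplicitComplexity.STA (Deriv Ctx Term LinTy SoftTy encWord encBit tyS tyB tyF mpxRen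
  liftRen)

/-! ## §B.10 Under the binder of the tail: `λz. chain` -/

/-- Inner heads (under `λz`) are outer heads shifted; recover the outer heads behind a lifted renaming. [folklore] -/
theorem map_liftRen_eq_map_succ {f : ℕ → ℕ} :
    ∀ {hs' ho : List ℕ}, hs'.map (liftRen f) = ho.map (· + 1) → ∃ ho' : List ℕ, hs' = ho'.map (· + 1) ∧ ho'.map f = ho
  | [], ho, h => by
      cases ho with
      | nil => exact ⟨[], rfl, rfl⟩
      | cons _ _ => simp at h
  | a :: hs', ho, h => by
      cases ho with
      | nil => simp at h
      | cons c ho =>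
        simp only [List.map_cons, List.cons.injEq] at h
        obtain ⟨a', rfl, ha'⟩ := liftRen_eq_succ h.1
        obtain ⟨ho', rfl, hho⟩ := map_liftRen_eq_map_succ h.2
        exact ⟨a' :: ho', rfl, by rw [List.map_cons, ha', hho]⟩

/-- Leaving the binder of the tail: inner head slots `c + 1` are outer slots `c`, the excluded tail slot disappears.
[folklore] -/
theorem HeadsDesc.unshift0 {o : Option SoftTy} {Γ : Ctx} {ρ : Val} {ho : List ℕ} {J : ℕ} {qs P R : ℕ → Point}
    (h : HeadsDesc (Ctx.cons o Γ) ρ (ho.map (· + 1)) {0} J qs P R) : HeadsDesc Γ (Val.unshift ρ) ho ∅ J qs P R := by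
  obtain ⟨hH, hN, hC⟩ := h
  refine ⟨fun s hs => (hH (s + 1) (List.mem_map.2 ⟨s, hs, rfl⟩)).unshift,
    fun s hs _ => (hN (s + 1) (fun hm => ?_) (by simp)).unshift, fun j hj => ?_⟩
  · obtain ⟨s', hs', he⟩ := List.mem_map.1 hm
    obtain rfl : s' = s := by omega
    exact hs hs'
  · obtain ⟨s, hs, σ, V, hΓs, hρs, hm⟩ := hC j hj
    obtain ⟨c, hc, rfl⟩ := List.mem_map.1 hs
    exact ⟨c, hc, σ, V, hΓs, hρs, hm⟩

/-- `(m)` below an abstracted chain (no tail slot in the context). [cite: LaurentTortoraDeFalco2006, Def. 12] -/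
theorem HeadsDesc.mpx_empty {Γ : Ctx} {ρ : Val} {hs₀ : List ℕ} {J : ℕ} {qs P R : ℕ → Point}
    (hH : HeadsDesc Γ ρ hs₀ ∅ J qs P R) {S : Finset ℕ} {j : ℕ} {τ₀ : SoftTy} (hS : ∀ s ∈ S, Γ s = some τ₀)
    (hj : Γ j = none) (hhp : ∀ c ∈ hs₀, ∃ τ, Γ c = some τ) :
    HeadsDesc (Γ.mpx S j τ₀) (mpxVal S j ρ) (hs₀.map (mpxRen S j)) ∅ J qs P R := by
  obtain ⟨hHd, hN, hC⟩ := hH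
  have hjS : j ∉ S := fun hj' => by simpa [hj] using hS j hj'
  have hf_mem : ∀ {i}, i ∈ S → mpxRen S j i = j := fun hi => by simp [mpxRen, hi]
  have hf_nmem : ∀ {i}, i ∉ S → mpxRen S j i = i := fun hi => by simp [mpxRen, hi]
  have hjh : j ∉ hs₀ := fun hm => by obtain ⟨τ, hτ⟩ := hhp j hm; rw [hj] at hτ; cases hτ
  refine ⟨fun s hs' => ?_, fun s hs₁ _ => ?_, fun j' hj' => ?_⟩
  · obtain ⟨c₀, hc₀, rfl⟩ := List.mem_map.1 hs'
    by_cases hcS : c₀ ∈ S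
    · rw [hf_mem hcS]
      refine SlotIn.mpx_self (boxable_argClique _) hS hj fun i hi => ?_
      by_cases hih : i ∈ hs₀
      · exact hHd i hih
      · exact (hN i hih (Set.notMem_empty _)).mono fun k => junk_subset_argClique _ k
    · rw [hf_nmem hcS]
      exact (hHd c₀ hc₀).mpx_of_not_mem hcS fun e => hjh (e ▸ hc₀)
  · by_cases hsS : s ∈ S
    · exact SlotIn.mpx_of_mem hsS
    · by_cases hsj : s = j
      · subst hsj
        refine SlotIn.mpx_self boxable_junk hS hj fun i hi => hN i (fun hih => ?_) (Set.notMem_empty _)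
        exact hs₁ (List.mem_map.2 ⟨i, hih, hf_mem hi⟩)
      · have hsh : s ∉ hs₀ := fun h => hs₁ (List.mem_map.2 ⟨s, h, hf_nmem hsS⟩)
        exact (hN s hsh (Set.notMem_empty _)).mpx_of_not_mem hsS hsj
  · obtain ⟨s₀, hs₀m, σ, V, hΓs, hρs, hm⟩ := hC j' hj'
    refine ⟨mpxRen S j s₀, List.mem_map.2 ⟨s₀, hs₀m, rfl⟩, ?_⟩
    by_cases hsS : s₀ ∈ S
    · rw [hf_mem hsS]
      have hσ : σ = τ₀ := by have := hS s₀ hsS; rw [hΓs] at this; cases this; rfl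
      subst hσ
      refine ⟨σ.bang, Point.ofCourse (S.val.map ρ.label), by simp [Ctx.mpx, hjS], by simp [mpxVal, hjS], ?_⟩
      show occPt (P j') (R j') (qs j') ∈ leafSet (σ.bangs + 1) _
      rw [mem_leafSet_ofCourse]
      exact ⟨V, Multiset.mem_map.2 ⟨s₀, Finset.mem_def.1 hsS, by simp [Val.label, hρs]⟩, hm⟩
    · rw [hf_nmem hsS]
      have hsj : s₀ ≠ j := fun e => by rw [e, hj] at hΓs; cases hΓs
      exact ⟨σ, V, by simp [Ctx.mpx, hsS, hsj, hΓs], by simp [mpxVal, hsS, hsj, hρs], hm⟩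

/-- The tail LABEL (the consumed slot of `z`, linear): used once at the last chain value, or `![]` after a discarded
rest. [cite: LaurentTortoraDeFalco2006, Def. 12] -/
def LamzTail (Vz : Point) (n J : ℕ) (qs R : ℕ → Point) : Prop :=
  (J = n ∧ (∀ j, j + 1 = n → R j = bang1 (qs n)) ∧ Vz = bang1 (qs n)) ∨ (1 ≤ J ∧ R (J - 1) = bang0 ∧ Vz = bang0)

/-- A derivation of `λz. chain` has every (outer) head in its context. [cite: GaboardiMarionRonchidellarocca2008, Table 2] -/
theorem lamz_present : {d : ℕ} → {Γ : Ctx} → {M : Term} → {σ : SoftTy} → (D : Deriv d Γ M σ) → {C : Term} →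
    {bs : List Bool} → {ho : List ℕ} → M = .lam C → IsChain 0 C bs (ho.map (· + 1)) → ∀ c ∈ ho, ∃ τ, Γ c = some τ
  | _, _, _, _, .ax _, _, _, _, hM, _ => by cases hM
  | _, _, _, _, .weak j A h hj hΓ', C, bs, ho, hM, hC => by
      intro c hc
      obtain ⟨τ, hτ⟩ := lamz_present h hM hC c hc
      have hcj : c ≠ j := fun e => by rw [e, hj] at hτ; cases hτ
      exact ⟨τ, by rw [hΓ', Function.update_of_ne hcj, hτ]⟩
  | _, _, _, _, .lam h, C, bs, ho, hM, hC => by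
      cases hM
      intro c hc
      exact (chain_present h hC).2 (c + 1) (List.mem_map.2 ⟨c, hc, rfl⟩)
  | _, _, _, _, .app _ _ _, _, _, _, hM, _ => by cases hM
  | _, _, _, _, .mpx (Γ := Γ) (σ := τ₀) S j h hS hj hΓ' hM', C, bs, ho, hM, hC => by
      rw [hM] at hM'
      obtain ⟨C₀, e, hC₀r⟩ := rename_eq_lam hM'.symm
      obtain ⟨z', hs', hC₀, hz', hhs⟩ := hC.of_rename hC₀r
      obtain rfl := liftRen_eq_zero hz'
      obtain ⟨ho', rfl, rfl⟩ := map_liftRen_eq_map_succ hhs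
      have hjS : j ∉ S := fun hj' => by simpa [hj] using hS j hj'
      intro c hc
      obtain ⟨c₀, hc₀, rfl⟩ := List.mem_map.1 hc
      obtain ⟨τ, hτ⟩ := lamz_present h e hC₀ c₀ hc₀
      have hcj : c₀ ≠ j := fun e => by rw [e, hj] at hτ; cases hτ
      by_cases hcS : c₀ ∈ S
      · exact ⟨τ₀.bang, by rw [hΓ']; simp [mpxRen, hcS, Ctx.mpx, hjS]⟩
      · exact ⟨τ, by rw [hΓ']; simp [mpxRen, hcS, Ctx.mpx, hcj, hτ]⟩
  | _, _, _, _, .sp h _, C, bs, ho, hM, hC => by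
      intro c hc
      obtain ⟨τ, hτ⟩ := lamz_present h hM hC c hc
      exact ⟨τ.bang, by subst_vars; simp [Ctx.bang, hτ]⟩
  | _, _, _, _, .allI h hΔ, C, bs, ho, hM, hC => by
      intro c hc
      obtain ⟨τ, hτ⟩ := lamz_present h hM hC c hc
      rw [hΔ] at hτ
      simp only [Ctx.shift, Option.map_eq_some_iff] at hτ
      obtain ⟨τ', hτ', -⟩ := hτ
      exact ⟨τ', hτ'⟩
  | _, _, _, _, .allE _ h, _, _, _, hM, hC => lamz_present h hM hC
  | _, _, _, _, .sum _ _, _, _, _, hM, _ => by cases hM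

/-- **Runs of `λz. chain`.** The result is `Vz‾ ⅋ q` with chain data; the (outer) heads carry box trees over the
occurrence points, other slots junk, every occurrence point a real leaf of a head slot; the tail label `Vz` is
`![qs |bs|]` or `![]`. [cite: LaurentTortoraDeFalco2006, Def. 12] -/
theorem lamz_runs : {d : ℕ} → {Γ : Ctx} → {M : Term} → {σ : SoftTy} → (D : Deriv d Γ M σ) → {C : Term} →
    {bs : List Bool} → {ho : List ℕ} → M = .lam C → IsChain 0 C bs (ho.map (· + 1)) → σ.bangs = 0 → ArrLike σ.lin →
    (∀ c ∈ ho, ∃ k K, Γ c = some ⟨k, K⟩ ∧ KernelOK K) →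
      ∀ {ρ : Val} {x : Point}, (ρ, x) ∈ D.interp → ∃ Vz q J qs P R, x = Vz.dual.par q ∧ qs 0 = q ∧
        ChainData bs J qs P R ∧ HeadsDesc Γ ρ ho ∅ J qs P R ∧ LamzTail Vz bs.length J qs R
  | _, _, _, _, .ax _, _, _, _, hM, _, _, _, _, _, _, _ => by cases hM
  | _, _, _, _, .weak (Γ := Γ) j A h hj hΓ', C, bs, ho, hM, hC, hσ, hA, hK, ρ, x, hr => by
      have hhp := lamz_present h hM hC
      have hK' : ∀ c ∈ ho, ∃ k K, Γ c = some ⟨k, K⟩ ∧ KernelOK K := fun c hc => by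
        obtain ⟨k, K, hΓc, hKc⟩ := hK c hc
        obtain ⟨τ', hτ'⟩ := hhp c hc
        have hcj : c ≠ j := fun e => by rw [e, hj] at hτ'; cases hτ'
        rw [hΓ', Function.update_of_ne hcj] at hΓc
        exact ⟨k, K, hΓc, hKc⟩
      obtain ⟨ρ', p, hm, he⟩ := hr
      obtain ⟨Vz, q, J, qs, P, R, hx, hq, hD, hH, hT⟩ := lamz_runs h hM hC hσ hA hK' hm
      simp only [Prod.mk.injEq] at he
      obtain ⟨rfl, rfl⟩ := he
      subst hΓ'
      exact ⟨Vz, q, J, qs, P, R, hx, hq, hD, hH.weak hj A, hT⟩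
  | _, _, _, _, .lam (k := kz) (B := Bz) (Γ := Γ) h, C, bs, ho, hM, hC, _, hA, hK, ρ, x, hr => by
      cases hM
      obtain rfl : kz = 0 := hA kz Bz _ rfl
      obtain ⟨ρ₁, p, Vz, hm, h0, he⟩ := hr
      simp only [Prod.mk.injEq] at he
      obtain ⟨rfl, rfl⟩ := he
      have hKin : ∀ c ∈ ho.map (· + 1), ∃ k K, Ctx.cons (some ⟨0, Bz⟩) Γ c = some ⟨k, K⟩ ∧ KernelOK K := by
        intro c hc
        obtain ⟨c₀, hc₀, rfl⟩ := List.mem_map.1 hc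
        exact hK c₀ hc₀
      obtain ⟨J, qs, P, R, hq, hD, hH, hT⟩ := chain_runs h hC rfl (by simp) hKin hm
      refine ⟨Vz, p, J, qs, P, R, rfl, hq, hD, hH.unshift0, ?_⟩
      rcases hT with ⟨h1, h2, h3⟩ | ⟨h1, h2, h3⟩
      · obtain ⟨V, hV, hVm⟩ := h3 ⟨0, Bz⟩ rfl
        rw [h0] at hV; cases hV
        exact Or.inl ⟨h1, h2, hVm⟩
      · obtain ⟨V, hV, hVm⟩ := h3 ⟨0, Bz⟩ rfl
        rw [h0] at hV; cases hV
        exact Or.inr ⟨h1, h2, hVm⟩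
  | _, _, _, _, .app _ _ _, _, _, _, hM, _, _, _, _, _, _, _ => by cases hM
  | _, _, _, _, .mpx (Γ := Γ) (σ := τ₀) S j h hS hj hΓ' hM', C, bs, ho, hM, hC, hσ, hA, hK, ρ, x, hr => by
      rw [hM] at hM'
      obtain ⟨C₀, e, hC₀r⟩ := rename_eq_lam hM'.symm
      obtain ⟨z', hs', hC₀, hz', hhs⟩ := hC.of_rename hC₀r
      obtain rfl := liftRen_eq_zero hz'
      obtain ⟨ho', rfl, rfl⟩ := map_liftRen_eq_map_succ hhs
      have hhp := lamz_present h e hC₀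
      have hjS : j ∉ S := fun hj' => by simpa [hj] using hS j hj'
      have hK₀ : ∀ c ∈ ho', ∃ k K, Γ c = some ⟨k, K⟩ ∧ KernelOK K := by
        intro c₀ hc₀
        obtain ⟨k, K, hΓc, hKc⟩ := hK _ (List.mem_map.2 ⟨c₀, hc₀, rfl⟩)
        obtain ⟨τ', hτ'⟩ := hhp c₀ hc₀
        have hcj : c₀ ≠ j := fun e => by rw [e, hj] at hτ'; cases hτ'
        rw [hΓ'] at hΓc
        by_cases hcS : c₀ ∈ S
        · simp only [mpxRen, hcS, if_true, Ctx.mpx, hjS, if_false, Option.some.injEq] at hΓc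
          refine ⟨τ₀.bangs, K, ?_, hKc⟩
          rw [hS c₀ hcS, ← show τ₀.lin = K from congrArg SoftTy.lin hΓc]
        · simp only [mpxRen, hcS, if_false, Ctx.mpx, hcj] at hΓc
          exact ⟨k, K, hΓc, hKc⟩
      obtain ⟨ρ', p, hm, he'⟩ := hr
      obtain ⟨Vz, q, J, qs, P, R, hx, hq, hD, hH, hT⟩ := lamz_runs h e hC₀ hσ hA hK₀ hm
      simp only [Prod.mk.injEq] at he'
      obtain ⟨rfl, rfl⟩ := he'
      subst hΓ'
      exact ⟨Vz, q, J, qs, P, R, hx, hq, hD, hH.mpx_empty hS hj hhp, hT⟩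
  | _, _, _, _, .sp _ _, _, _, _, _, _, hσ, _, _, _, _, _ => by simp at hσ
  | _, _, _, _, .allI (Γ := Γ) h hΔ, C, bs, ho, hM, hC, _, hA, hK, ρ, x, hr => by
      have hK' : ∀ c ∈ ho, ∃ k K, Γ.shift c = some ⟨k, K⟩ ∧ KernelOK K := fun c hc => by
        obtain ⟨k, K, hΓc, hKc⟩ := hK c hc
        exact ⟨k, K.rename Nat.succ, by simp [Ctx.shift, hΓc]; rfl, hKc.rename_succ⟩
      rw [← hΔ] at hK'
      obtain ⟨Vz, q, J, qs, P, R, hx, hq, hD, hH, hT⟩ :=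
        lamz_runs h hM hC rfl (fun k B C hp => hA k B C hp) hK' hr
      rw [hΔ] at hH
      exact ⟨Vz, q, J, qs, P, R, hx, hq, hD, hH.of_shift, hT⟩
  | _, _, _, _, .allE _ h, _, _, _, hM, hC, _, hA, hK, _, _, hr =>
      lamz_runs h hM hC rfl (fun k B C hp => hA.of_substp k B C hp) hK hr
  | _, _, _, _, .sum _ _, _, _, _, hM, _, _, _, _, _, _, _ => by cases hM

/-- **Existence of the canonical run of `λz. chain`**: result `![qs |bs|]‾ ⅋ qs 0`, every position evaluated
canonically. [cite: LaurentTortoraDeFalco2006, Def. 12] -/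
theorem lamz_exists : {d : ℕ} → {Γ : Ctx} → {M : Term} → {σ : SoftTy} → (D : Deriv d Γ M σ) → {C : Term} →
    {bs : List Bool} → {ho : List ℕ} → M = .lam C → IsChain 0 C bs (ho.map (· + 1)) → σ.bangs = 0 → ArrLike σ.lin →
    (∀ c ∈ ho, ∃ k K, Γ c = some ⟨k, K⟩ ∧ KernelOK K) →
      ∀ as qs : ℕ → Point, ∃ ρ : Val, (ρ, (bang1 (qs bs.length)).dual.par (qs 0)) ∈ D.interp ∧
        HeadsDesc Γ ρ ho ∅ bs.length qs (canonP bs as) (canonR qs)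
  | _, _, _, _, .ax _, _, _, _, hM, _, _, _, _, _, _ => by cases hM
  | _, _, _, _, .weak (Γ := Γ) j A h hj hΓ', C, bs, ho, hM, hC, hσ, hA, hK, as, qs => by
      have hhp := lamz_present h hM hC
      have hK' : ∀ c ∈ ho, ∃ k K, Γ c = some ⟨k, K⟩ ∧ KernelOK K := fun c hc => by
        obtain ⟨k, K, hΓc, hKc⟩ := hK c hc
        obtain ⟨τ', hτ'⟩ := hhp c hc
        have hcj : c ≠ j := fun e => by rw [e, hj] at hτ'; cases hτ'
        rw [hΓ', Function.update_of_ne hcj] at hΓc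
        exact ⟨k, K, hΓc, hKc⟩
      obtain ⟨ρ, hm, hH⟩ := lamz_exists h hM hC hσ hA hK' as qs
      subst hΓ'
      exact ⟨_, ⟨ρ, _, hm, rfl⟩, hH.weak hj A⟩
  | _, _, _, _, .lam (k := kz) (B := Bz) (Γ := Γ) h, C, bs, ho, hM, hC, _, hA, hK, as, qs => by
      cases hM
      obtain rfl : kz = 0 := hA kz Bz _ rfl
      have hKin : ∀ c ∈ ho.map (· + 1), ∃ k K, Ctx.cons (some ⟨0, Bz⟩) Γ c = some ⟨k, K⟩ ∧ KernelOK K := by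
        intro c hc
        obtain ⟨c₀, hc₀, rfl⟩ := List.mem_map.1 hc
        exact hK c₀ hc₀
      obtain ⟨ρ₁, hm, hH, hT⟩ := chain_exists h hC rfl (by simp) hKin as qs
      obtain ⟨V, hV, hVm⟩ := hT.canon ⟨0, Bz⟩ rfl
      exact ⟨_, ⟨ρ₁, qs 0, bang1 (qs bs.length), hm, by rw [hV, show V = bang1 (qs bs.length) from hVm], rfl⟩,
        hH.unshift0⟩
  | _, _, _, _, .app _ _ _, _, _, _, hM, _, _, _, _, _, _ => by cases hM
  | _, _, _, _, .mpx (Γ := Γ) (σ := τ₀) S j h hS hj hΓ' hM', C, bs, ho, hM, hC, hσ, hA, hK, as, qs => by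
      rw [hM] at hM'
      obtain ⟨C₀, e, hC₀r⟩ := rename_eq_lam hM'.symm
      obtain ⟨z', hs', hC₀, hz', hhs⟩ := hC.of_rename hC₀r
      obtain rfl := liftRen_eq_zero hz'
      obtain ⟨ho', rfl, rfl⟩ := map_liftRen_eq_map_succ hhs
      have hhp := lamz_present h e hC₀
      have hjS : j ∉ S := fun hj' => by simpa [hj] using hS j hj'
      have hK₀ : ∀ c ∈ ho', ∃ k K, Γ c = some ⟨k, K⟩ ∧ KernelOK K := by
        intro c₀ hc₀
        obtain ⟨k, K, hΓc, hKc⟩ := hK _ (List.mem_map.2 ⟨c₀, hc₀, rfl⟩)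
        obtain ⟨τ', hτ'⟩ := hhp c₀ hc₀
        have hcj : c₀ ≠ j := fun e => by rw [e, hj] at hτ'; cases hτ'
        rw [hΓ'] at hΓc
        by_cases hcS : c₀ ∈ S
        · simp only [mpxRen, hcS, if_true, Ctx.mpx, hjS, if_false, Option.some.injEq] at hΓc
          refine ⟨τ₀.bangs, K, ?_, hKc⟩
          rw [hS c₀ hcS, ← show τ₀.lin = K from congrArg SoftTy.lin hΓc]
        · simp only [mpxRen, hcS, if_false, Ctx.mpx, hcj] at hΓc
          exact ⟨k, K, hΓc, hKc⟩
      obtain ⟨ρ, hm, hH⟩ := lamz_exists h e hC₀ hσ hA hK₀ as qs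
      subst hΓ'
      exact ⟨_, ⟨ρ, _, hm, rfl⟩, hH.mpx_empty hS hj hhp⟩
  | _, _, _, _, .sp _ _, _, _, _, _, _, hσ, _, _, _, _ => by simp at hσ
  | _, _, _, _, .allI (Γ := Γ) h hΔ, C, bs, ho, hM, hC, _, hA, hK, as, qs => by
      have hK' : ∀ c ∈ ho, ∃ k K, Γ.shift c = some ⟨k, K⟩ ∧ KernelOK K := fun c hc => by
        obtain ⟨k, K, hΓc, hKc⟩ := hK c hc
        exact ⟨k, K.rename Nat.succ, by simp [Ctx.shift, hΓc]; rfl, hKc.rename_succ⟩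
      rw [← hΔ] at hK'
      obtain ⟨ρ, hm, hH⟩ := lamz_exists h hM hC rfl (fun k B C hp => hA k B C hp) hK' as qs
      rw [hΔ] at hH
      exact ⟨ρ, hm, hH.of_shift⟩
  | _, _, _, _, .allE _ h, _, _, _, hM, hC, _, hA, hK, as, qs =>
      lamz_exists h hM hC rfl (fun k B C hp => hA.of_substp k B C hp) hK as qs
  | _, _, _, _, .sum _ _, _, _, _, hM, _, _, _, _, _, _ => by cases hM

end Summit.PneNP.PneNP.Theorems.OracleRefusal.Negative
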